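import Summits.BirchSwinnertonDyer.BirchSwinnertonDyer.Theorems.SignedLowerHalvesSmallImageLowerHalfBothSignsRttD2SpecialisationOfSkeleton
import Summits.BirchSwinnertonDyer.BirchSwinnertonDyer.Theorems.SignedLowerHalvesSmallImageLowerHalfBothSignsRttE2KLambdaSocketLe
import HarnessLib

/-!
# Route `SignedLowerHalves`, crux L `SmallImageLowerHalfBothSigns` (item stmt-BirchSwinnertonDyer-23599), line `rtt_w3` v13 — E2, row D2-b: the glue's
# `hK`-SHAPED INEQUALITY from JLK's `Thm52Shape` specialised along `φ_b`, at `𝒪 = padicCoeffIntegers S`, `Λ_𝒪 = IwasawaAlgebraO S`: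
# «`D.Thm52Shape` ∧ `f`-regular ∧ defect `(H¹ ⧸ Z)[f] = 0` ⟹ `lambdaInvariant p ((H¹ ⧸ Z) ⧸ f) ≤ lambdaInvariant p (H² ⧸ f)`»

Width seat `bsd-line-slh-p3-w3` g19 under LEAD `cruxlead-stmt-BirchSwinnertonDyer-23599` g9 (GO 14:01:41Z, D2 DEFINER, part (D2-b)); ROUTE-INDEPENDENT helper
(`--supports stmt-BirchSwinnertonDyer-23599`); THEOREMS ONLY — no definition, no named fact, no instance, no `sorry`; closes nothing; BSD / E2 / crux L
are proved for NO curve by this. The Galois side (which `ZetaSkeleton` over `𝒪⟦T₂⟧⟦T₁⟧`, the descent sequence `0 → H¹₂/f → H¹_θ → H²₂[f] → 0`,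
`X' ↔ Dψ.X`) is row D2-seq (LEAD successor) and is NOT touched here.

WHAT. `R = 𝒪⟦T₂⟧⟦T₁⟧ = PowerSeries (IwasawaAlgebraO S)`, `f = C (X − C b)`, `φ : R →+* Λ_𝒪` with the inner-evaluation clauses (`φ f = 0`,
`φ (C (C a)) = C a`, `φ X = X`, `ker φ = (f)`), `ι = PowerSeries.map C : Λ_𝒪 → R` (so `φ ∘ ι = id`). For a `ZetaSkeleton R Aidx H0 H1 H2` with `H1`, `H2`
finitely generated, `D.Thm52Shape`, `¬ char_R(H2) ≤ (f)` and `torsionBy R (H1 ⧸ D.Z) f = ⊥`: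
* ★★ `lambdaInvariant_quotSMulTop_le_of_thm52Shape` — for ANY `Λ = ℤ_p⟦T⟧`-structures on `QuotSMulTop f (H1 ⧸ D.Z)` and `QuotSMulTop f H2` pinned by
  `r • x = (ι (iwasawaToIwasawaO S r)) • x`: `lambdaInvariant p (QuotSMulTop f (H1 ⧸ D.Z)) ≤ lambdaInvariant p (QuotSMulTop f H2)`.
  Chain: p776030 `charIdeal_specialisation_mul_eq_of_thm52Shape` (`char((H¹⧸Z)/f)·char(H²[f]) = char(H²/f)·char((H¹⧸Z)[f])`) + defect `= 1` +
  p776193 `lambdaInvariant_le_of_charIdeal_mul_eq_of_algebraMap_eq` (`char M · J = char N ⟹ λ M ≤ λ N`).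
With `Hsp ⧸ ZSp ≅ QuotSMulTop f (H1 ⧸ D.Z)` (`SmallImageRttD2Descent.nonempty_quotSMulTop_quotient_linearEquiv_quotient_map`, p776060) this is the glue's
`hK : lambdaInvariant p (H ⧸ Λ_𝒪∙z) ≤ lambdaInvariant p Y` for `H := Hsp`, `Y := Ysp` as soon as `ZSp = Λ_𝒪∙z` (one zeta element after specialisation).

References: [JohnsonLeungKings2011] Thm. 5.2, Cor. 5.3, Lemma 4.4; [Washington1997] §13.2; [BourbakiAC5to7] VII §4.5.
-/

set_option autoImplicit false
-- the Theorems namespace of this sub repeats the summit name by design (D-0017 nested layout)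
set_option linter.dupNamespace false

noncomputable section

open scoped Pointwise
open PowerSeries Literature.NumberTheory.Automorphic Literature.NumberTheory.EllipticCurves Literature.NumberTheory.EllipticCurves.Module
open Literature.NumberTheory.ComplexMultiplication.EllipticUnits.JohnsonLeungKings2011
open Summit.BirchSwinnertonDyer.BirchSwinnertonDyer.Theorems.SignedBaseChangeAcDivSpecialization.LocalLength

namespace Summit.BirchSwinnertonDyer.BirchSwinnertonDyer.Theorems.SmallImageRttD2LamSpec

universe v

variable (p : ℕ) [Fact p.Prime] (S : Set (PadicAlgCl p)) [FiniteDimensional ℚ_[p] (padicCoeffField S)]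
  (b : padicCoeffIntegers S) (φ : PowerSeries (IwasawaAlgebraO S) →+* IwasawaAlgebraO S)
  (hφf : φ (C (X - C b)) = 0) (hC : ∀ a : padicCoeffIntegers S, φ (C (C a)) = C a) (hX : φ X = X)
  (hker : RingHom.ker φ = Ideal.span {C (X - C b)})

include hφf hC hX hker in
/-- ★★ **The glue's `hK`-shaped inequality from `Thm52Shape`, road D.** `𝒪 = padicCoeffIntegers S` (`ℚ_p(S)/ℚ_p` finite), `Λ_𝒪 = 𝒪⟦T⟧`,
`R = 𝒪⟦T₂⟧⟦T₁⟧`, `f = C (X − C b)`, `φ : R →+* Λ_𝒪` with the inner-evaluation clauses, `ι = PowerSeries.map C`. Let `D` be a `ZetaSkeleton` over `R`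
with `H1`, `H2` finitely generated, `D.Thm52Shape`, `f`-regularity `¬ char_R(H2) ≤ (f)` and vanishing defect `torsionBy R (H1 ⧸ D.Z) f = ⊥`. Then for
any `Λ = ℤ_p⟦T⟧`-module structures on `QuotSMulTop f (H1 ⧸ D.Z)` and `QuotSMulTop f H2` through `ι ∘ iwasawaToIwasawaO S`
(`r • x = (ι (iwasawaToIwasawaO S r)) • x`): `lambdaInvariant p (QuotSMulTop f (H1 ⧸ D.Z)) ≤ lambdaInvariant p (QuotSMulTop f H2)`.
(`char((H¹⧸Z)/f)·char(H²[f]) = char(H²/f)·1`, then the one-sided (K)-socket.) [cite: JohnsonLeungKings2011, Thm. 5.2, Cor. 5.3] [cite: Washington1997, §13.2] -/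
theorem lambdaInvariant_quotSMulTop_le_of_thm52Shape {Aidx H0 H1 H2 : Type v} [AddCommGroup H0]
    [Module (PowerSeries (IwasawaAlgebraO S)) H0] [AddCommGroup H1] [Module (PowerSeries (IwasawaAlgebraO S)) H1] [AddCommGroup H2]
    [Module (PowerSeries (IwasawaAlgebraO S)) H2] [Module.Finite (PowerSeries (IwasawaAlgebraO S)) H1]
    [Module.Finite (PowerSeries (IwasawaAlgebraO S)) H2]
    (D : ZetaSkeleton (PowerSeries (IwasawaAlgebraO S)) Aidx H0 H1 H2) (h52 : D.Thm52Shape)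
    (hreg : ¬ charIdeal (PowerSeries (IwasawaAlgebraO S)) H2 ≤ Ideal.span {(C (X - C b) : PowerSeries (IwasawaAlgebraO S))})
    (hdef : Submodule.torsionBy (PowerSeries (IwasawaAlgebraO S)) (H1 ⧸ D.Z) (C (X - C b)) = ⊥)
    [Module (IwasawaAlgebra p) (QuotSMulTop (C (X - C b) : PowerSeries (IwasawaAlgebraO S)) (H1 ⧸ D.Z))]
    [Module (IwasawaAlgebra p) (QuotSMulTop (C (X - C b) : PowerSeries (IwasawaAlgebraO S)) H2)]
    (hΛ1 : ∀ (r : IwasawaAlgebra p) (x : QuotSMulTop (C (X - C b) : PowerSeries (IwasawaAlgebraO S)) (H1 ⧸ D.Z)),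
      r • x = (PowerSeries.map (PowerSeries.C : padicCoeffIntegers S →+* IwasawaAlgebraO S) (iwasawaToIwasawaO S r)) • x)
    (hΛ2 : ∀ (r : IwasawaAlgebra p) (x : QuotSMulTop (C (X - C b) : PowerSeries (IwasawaAlgebraO S)) H2),
      r • x = (PowerSeries.map (PowerSeries.C : padicCoeffIntegers S →+* IwasawaAlgebraO S) (iwasawaToIwasawaO S r)) • x) :
    lambdaInvariant p (QuotSMulTop (C (X - C b) : PowerSeries (IwasawaAlgebraO S)) (H1 ⧸ D.Z)) ≤
      lambdaInvariant p (QuotSMulTop (C (X - C b) : PowerSeries (IwasawaAlgebraO S)) H2) := by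
  -- `𝒪` is a DVR
  haveI : IsDiscreteValuationRing (padicCoeffIntegers S) := by
    rw [padicCoeffIntegers_eq_unitBall S]; exact LambdaLowerBoundO.isDiscreteValuationRing_unitBall p _
  haveI : UniqueFactorizationMonoid (PowerSeries (IwasawaAlgebraO S)) :=
    Literature.NumberTheory.IwasawaTheory.uniqueFactorizationMonoid_powerSeries_powerSeries (padicCoeffIntegers S)
  -- the `Λ_𝒪`-structures by restriction along `ι`
  letI : Algebra (IwasawaAlgebraO S) (PowerSeries (IwasawaAlgebraO S)) :=
    (PowerSeries.map (PowerSeries.C : padicCoeffIntegers S →+* IwasawaAlgebraO S)).toAlgebra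
  letI i1 : Module (IwasawaAlgebraO S) (H1 ⧸ D.Z) :=
    Module.compHom (H1 ⧸ D.Z) (PowerSeries.map (PowerSeries.C : padicCoeffIntegers S →+* IwasawaAlgebraO S))
  letI i2 : Module (IwasawaAlgebraO S) H2 := Module.compHom H2 (PowerSeries.map (PowerSeries.C : padicCoeffIntegers S →+* IwasawaAlgebraO S))
  haveI : IsScalarTower (IwasawaAlgebraO S) (PowerSeries (IwasawaAlgebraO S)) (H1 ⧸ D.Z) := IsScalarTower.of_algebraMap_smul fun _ _ ↦ rfl
  haveI : IsScalarTower (IwasawaAlgebraO S) (PowerSeries (IwasawaAlgebraO S)) H2 := IsScalarTower.of_algebraMap_smul fun _ _ ↦ rfl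
  -- p776030: the specialised skeleton identity
  have key := charIdeal_specialisation_mul_eq_of_thm52Shape b φ hφf hC hX hker D h52 hreg
  -- the defect term is `1`
  have hJ : charIdeal (IwasawaAlgebraO S)
      (Submodule.torsionBy (PowerSeries (IwasawaAlgebraO S)) (H1 ⧸ D.Z) (C (X - C b))) = 1 := by
    haveI : Subsingleton (Submodule.torsionBy (PowerSeries (IwasawaAlgebraO S)) (H1 ⧸ D.Z) (C (X - C b))) := by
      rw [hdef]; infer_instance
    unfold charIdeal
    exact finprod_mem_of_eqOn_one fun 𝔭 _ ↦ by rw [lengthAt_eq_zero_of_subsingleton, ENat.toNat_zero, pow_zero]; rfl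
  rw [hJ, mul_one] at key
  -- finiteness / torsion over `Λ_𝒪` of the two specialised modules (p775349)
  obtain ⟨⟨-, -, htorsA, htorsB⟩, hchar⟩ := h52
  obtain ⟨tA, htA, htA0⟩ := Submodule.annihilator_top_inter_nonZeroDivisors htorsA
  obtain ⟨tB, htB, htB0⟩ := Submodule.annihilator_top_inter_nonZeroDivisors htorsB
  have htA' : ∀ m : H1 ⧸ D.Z, tA • m = 0 := fun m ↦ Submodule.mem_annihilator.mp htA m Submodule.mem_top
  have htB' : ∀ m : H2, tB • m = 0 := fun m ↦ Submodule.mem_annihilator.mp htB m Submodule.mem_top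
  obtain ⟨g, hg⟩ := (isPrincipal_charIdeal_of_ufm (R := PowerSeries (IwasawaAlgebraO S)) (M := H2)).principal
  have hgB : charIdeal (PowerSeries (IwasawaAlgebraO S)) H2 = Ideal.span {g} := hg
  have hgA : charIdeal (PowerSeries (IwasawaAlgebraO S)) (H1 ⧸ D.Z) = Ideal.span {g} := by
    rw [show charIdeal (PowerSeries (IwasawaAlgebraO S)) (H1 ⧸ D.Z) = charIdeal (PowerSeries (IwasawaAlgebraO S)) H2 from hchar, hgB]
  have hg0 : φ g ≠ 0 := by
    intro h0
    apply hreg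
    rw [hgB, Ideal.span_singleton_le_iff_mem, ← hker]
    exact h0
  obtain ⟨hfinA, htorA, -, -⟩ := finite_isTorsion_quotSMulTop_torsionBy_of_innerEval b φ hφf hC hX hker (H1 ⧸ D.Z)
    (nonZeroDivisors.ne_zero htA0) htA' hgA hg0
  obtain ⟨hfinB, htorB, -, -⟩ := finite_isTorsion_quotSMulTop_torsionBy_of_innerEval b φ hφf hC hX hker H2
    (nonZeroDivisors.ne_zero htB0) htB' hgB hg0
  -- the glue's context: `Λ → Λ_𝒪` the structure map, towers from the pins
  letI : Algebra (IwasawaAlgebra p) (IwasawaAlgebraO S) := (iwasawaToIwasawaO S).toAlgebra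
  haveI : IsScalarTower (IwasawaAlgebra p) (IwasawaAlgebraO S) (QuotSMulTop (C (X - C b) : PowerSeries (IwasawaAlgebraO S)) (H1 ⧸ D.Z)) :=
    IsScalarTower.of_algebraMap_smul fun r x ↦ by
      rw [hΛ1 r x]
      exact (IsScalarTower.algebraMap_smul (PowerSeries (IwasawaAlgebraO S)) (iwasawaToIwasawaO S r) x).symm
  haveI : IsScalarTower (IwasawaAlgebra p) (IwasawaAlgebraO S) (QuotSMulTop (C (X - C b) : PowerSeries (IwasawaAlgebraO S)) H2) :=
    IsScalarTower.of_algebraMap_smul fun r x ↦ by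
      rw [hΛ2 r x]
      exact (IsScalarTower.algebraMap_smul (PowerSeries (IwasawaAlgebraO S)) (iwasawaToIwasawaO S r) x).symm
  exact SmallImageRttE2Num.lambdaInvariant_le_of_charIdeal_mul_eq_of_algebraMap_eq p S (fun _ ↦ rfl) _ _ htorA htorB _ key

end Summit.BirchSwinnertonDyer.BirchSwinnertonDyer.Theorems.SmallImageRttD2LamSpec

end
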